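import Literature.AlgebraicGeometry.Resolution.AbhyankarEtaleAscentProofs
import Literature.AlgebraicGeometry.Resolution.KnafKuhlmann2005Thm34HenselRoot
import Literature.AlgebraicGeometry.Resolution.AbhyankarRationalUniformization
import Literature.AlgebraicGeometry.Resolution.KnafKuhlmann2009Prop23
import Literature.AlgebraicGeometry.Resolution.ValuedFunctionFieldsLemmas
import Summits.ResolutionOfSingularities.ResolutionOfSingularities.Theorems.ValuativeLuAlphaPTorsorHenselRootChart
import Summits.ResolutionOfSingularities.ResolutionOfSingularities.Theorems.ValuativeLuAlphaPTorsorAdaptedDefs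
import Summits.ResolutionOfSingularities.ResolutionOfSingularities.Theorems.ValuativeLuAlphaPTorsorAdaptedHenselRootChartLevel
import Summits.ResolutionOfSingularities.ResolutionOfSingularities.Theorems.ValuativeLuAlphaPTorsorAdaptedHenselRootChartAssembly
import Summits.ResolutionOfSingularities.ResolutionOfSingularities.Theorems.ValuativeLuAlphaPTorsorAdaptedHenselRootChartPerron
import Mathlib.FieldTheory.Minpoly.IsIntegrallyClosed
import Mathlib.RingTheory.Polynomial.UniqueFactorization
import Mathlib.RingTheory.Polynomial.RationalRoot
import Mathlib.RingTheory.Polynomial.ScaleRoots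
import HarnessLib

/-!
# `α_p`-torsors along Abhyankar places of higher rank: the ADAPTED base chart from a Hensel root

Crux `Valuative.LuAlphaPTorsor` (item `stmt-ResolutionOfSingularities-0641`), line
`pfaff-line-log-final-forms`, registered stub `stub_adaptedHenselRootChart` (F3 of reshape
v6.3: wave 2, the open core `stub_abhyankarHigherRankCore` — zero-dimensional Abhyankar places
of rank `≥ 2`).

**Claim.** In the setting of S2 (`stub_henselRootChart`: `k` of characteristic `p`, `K/k`
finitely generated, `O ⊇ k` zero-dimensional of ANY rank, `M` finitely generated, Abhyankar,
residually separably generated, `K/M` algebraic), given the adapted unimodular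
re-parametrization of independent values (stub F¹ `stub_adaptedUnimodular`, taken as the first
hypothesis), there is a FLAG-ADAPTED very good chart `(R, x, lv)` of `M` (`FlagAdaptedChart` of
`…AdaptedDefs`: `R` finitely generated in `O ∩ M`, `M ⊆ Frac R`, the `xᵢ` generate the centre,
have `ℤ`-independent flag-adapted values, and (C3): at each level `ℓ` the parameters of level
`≥ ℓ` generate the ideal of elements smaller than every Laurent monomial of level `< ℓ`) with
`x` a transcendence basis of `K/k`.

Proof. Perron data `(x', η₁, g)` (`adHensel_perronData`, `…AdaptedHenselRootChartPerron`);
F¹ applied to the values `v(x'ᵢ)` and the unit vectors gives `C ∈ GLₙ(ℤ)` and levels `lv` with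
`x_j := x'^{C_j}` of flag-adapted values `< 1` and every `x'ᵢ` a monomial in the `xⱼ`; so
`k[x'] ⊆ k[x]`, `g` lifts to a monic `F ∈ k[X][T]` with `F(x; η₁) = 0`, and its reduction
`F(0; T)` has the residue of `η₁` as a simple root (`F ≡ F(0; T)` coefficientwise modulo `(x)`).
The chart is `R = k[x, η₁, 1/A]` of `adHensel_assembly` (`…AdaptedHenselRootChartAssembly`), `A`
the product of the level cofactors of `adHensel_level` (`…AdaptedHenselRootChartLevel`);
`R ⊆ M`, `M ⊆ k(x', η₁) ⊆ Frac R`, and `x` is algebraically independent (Gauss form) with `K`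
algebraic over `k(x) ⊇ k(x')`.
-/

-- single-problem summit: the doubled namespace component `ResolutionOfSingularities` is forced
set_option linter.dupNamespace false

namespace Summit.ResolutionOfSingularities.ResolutionOfSingularities.Theorems.PfaffLine

open IsLocalRing Polynomial Literature.AlgebraicGeometry.Resolution

/-! ### The stub -/

/-- **The ADAPTED base chart from a Hensel root** (stub F3 of line `pfaff-line-log-final-forms`,
reshape v6.3). For an intermediate field `M` of the finitely generated `K/k`, finitely
generated, along which the zero-dimensional `O ⊇ k` (of any rank) is an Abhyankar place with
separably generated residue field extension, and over which `K` is algebraic, there is a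
FLAG-ADAPTED very good chart of `M` (`FlagAdaptedChart`) whose parameters form a transcendence
basis of `K/k`. Proof: Perron data `(x', η₁, g)` (`adHensel_perronData`); the hypothesis `F¹`
(adapted unimodular re-parametrization, stub `stub_adaptedUnimodular`) applied to the values of
`x'` and the unit vectors gives `x_j = x'^{C_j}` with flag-adapted values such that the `x'ᵢ` are
monomials in the `xⱼ`, so `g` lifts to a monic `F ∈ k[X][T]` with `F(x; η₁) = 0` whose reduction
`F(0; T)` has the residue of `η₁` as a simple root; `adHensel_assembly` builds the chart
`k[x, η₁, 1/A]`. [cite: KnafKuhlmann2005, Thm. 3.4 and Thm. 4.1] -/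
theorem stub_adaptedHenselRootChart :
    ∀ p : ℕ, p.Prime → (∀ (Γ₀ : Type) [LinearOrderedCommGroupWithZero Γ₀] (n : ℕ) (τ : Fin n → Γ₀), (∀ i, τ i ≠ 0) → (∀ m : Fin n → ℤ, (∏ i, τ i ^ (m i)) = 1 → m = 0) → ∀ (H : Finset (Fin n → ℤ)), (∀ h ∈ H, (∏ i, τ i ^ (h i)) ≤ 1) → ∃ (C D : Matrix (Fin n) (Fin n) ℤ), C * D = 1 ∧ D * C = 1 ∧ (∀ j, (∏ i, τ i ^ (C j i)) < 1) ∧ (∀ h ∈ H, ∃ e : Fin n → ℕ, ∀ i, h i = ∑ j, (e j : ℤ) * C j i) ∧ ∃ lv : Fin n → ℕ, FlagAdaptedValues (fun j => ∏ i, τ i ^ (C j i)) lv) → ∀ (k K : Type) [Field k] [CharP k p] [Field K] [Algebra k K] (O : ValuationSubring K), (∀ c : k, algebraMap k K c ∈ O) → (⊤ : IntermediateField k K).FG → (∀ x : K, x ∈ O → ∃ f : Polynomial k, f ≠ 0 ∧ Polynomial.aeval x f ∈ O.nonunits) → ∀ (M : IntermediateField k K), M.FG → Literature.AlgebraicGeometry.Resolution.IsAbhyankarPlace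 O (algebraMap k K).fieldRange M.toSubfield → Literature.AlgebraicGeometry.Resolution.SeparablyGeneratedOver (Literature.AlgebraicGeometry.Resolution.resField O (algebraMap k K).fieldRange) (Literature.AlgebraicGeometry.Resolution.resField O M.toSubfield) → (∀ z : K, IsAlgebraic M z) → ∃ (n : ℕ) (R : Subalgebra k K) (hRO : R.toSubring ≤ O.toSubring) (x : Fin n → K) (hx : ∀ i, x i ∈ R) (lv : Fin n → ℕ), R ≤ M.toSubalgebra ∧ ((M : Set K) ⊆ Subfield.closure (R : Set K)) ∧ FlagAdaptedChart O R hRO x hx lv ∧ IsTranscendenceBasis k x := by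
  intro p _ F1 k K _ _ _ _ O hk _ hzd M hMfg hAbh hsep hKM
  classical
  obtain ⟨ρ, x', η₁, g, hx', hxi', hη₁O, hη₁M, hgmon, hgcoef, hgη, hgder, hMcl, hKalg⟩ :=
    adHensel_perronData O hk hzd M hMfg hAbh hsep hKM
  have hx'0 : ∀ j, x' j ≠ 0 := fun j => (hx' j).1
  have hvx' : ∀ j, O.valuation (x' j) < 1 := fun j => (hx' j).2.1
  -- F¹: flag-adapted unimodular re-parametrization of the values of `x'`
  set τ : Fin ρ → ValuationSubring.ValueGroup O := fun j => O.valuation (x' j) with hτ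
  have hτ0 : ∀ i, τ i ≠ 0 := fun i => (map_ne_zero O.valuation).mpr (hx'0 i)
  set H : Finset (Fin ρ → ℤ) := Finset.univ.image fun i => (Pi.single i 1 : Fin ρ → ℤ) with hH
  have hH1 : ∀ h ∈ H, (∏ i, τ i ^ (h i)) ≤ 1 := by
    intro h hh
    obtain ⟨i, -, rfl⟩ := Finset.mem_image.mp hh
    rw [adHensel_prod_zpow_single τ i]
    exact (hvx' i).le
  obtain ⟨C, D, hCD, -, hClt, hHrep, lv, hAV⟩ := F1 (ValuationSubring.ValueGroup O) ρ τ hτ0 hxi' H hH1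
  -- the new parameters `x_j = x'^{C_j}`
  set x : Fin ρ → K := fun j => ∏ i, x' i ^ (C j i) with hxdef
  have hvx : ∀ j, O.valuation (x j) = ∏ i, τ i ^ (C j i) := fun j => valuation_prod_zpow x' O (C j)
  have hx0 : ∀ j, x j ≠ 0 := fun j => prod_zpow_ne_zero x' hx'0 (C j)
  have hvx1 : ∀ j, O.valuation (x j) < 1 := fun j => by
    rw [hvx]
    exact hClt j
  have hxO : ∀ j, x j ∈ O := fun j => (O.valuation_le_one_iff _).mp (hvx1 j).le
  have hvxfun : (fun j => O.valuation (x j)) = fun j => ∏ i, τ i ^ (C j i) := funext hvx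
  -- the `x'ᵢ` are monomials in the `xⱼ`
  choose e he using fun i => hHrep (Pi.single i 1) (Finset.mem_image.mpr ⟨i, Finset.mem_univ _, rfl⟩)
  have hx'x : ∀ i, x' i = ∏ j, x j ^ (e i j) := by
    intro i
    calc x' i = ∏ i', x' i' ^ ((Pi.single i 1 : Fin ρ → ℤ) i') := (adHensel_prod_zpow_single x' i).symm
      _ = ∏ i', x' i' ^ (∑ j, (e i j : ℤ) * C j i') :=
          Finset.prod_congr rfl fun i' _ => by rw [he i i']
      _ = ∏ j, x j ^ ((e i j : ℤ)) := (adHensel_prod_zpow_matrix x' hx'0 C _).symm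
      _ = ∏ j, x j ^ (e i j) := by simp_rw [zpow_natCast]
  set B : Subalgebra k K := Algebra.adjoin k (Set.range x) with hB
  have hxB : ∀ j, x j ∈ B := fun j => Algebra.subset_adjoin ⟨j, rfl⟩
  have hx'B : ∀ i, x' i ∈ B := fun i => by
    rw [hx'x i]
    exact prod_mem fun j _ => pow_mem (hxB j) _
  have hA'B : Algebra.adjoin k (Set.range x') ≤ B := Algebra.adjoin_le (Set.range_subset_iff.mpr hx'B)
  -- value independence of `x`
  have hxi : ∀ m : Fin ρ → ℤ, (∏ j, O.valuation (x j) ^ (m j)) = 1 → m = 0 := by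
    intro m hm
    have h1 : (fun i => ∑ j, m j * C j i) = 0 := by
      refine hxi' _ ?_
      rw [← adHensel_prod_zpow_matrix τ hτ0 C m]
      simpa only [hvx] using hm
    have h2 : Matrix.vecMul m C = 0 := h1
    calc m = Matrix.vecMul (Matrix.vecMul m C) D := by
          rw [Matrix.vecMul_vecMul, hCD, Matrix.vecMul_one]
      _ = 0 := by rw [h2, Matrix.zero_vecMul]
  -- the monic `F ∈ k[X][T]` lifting `g`, with `F(x; η₁) = 0`
  have hgcoefB : ∀ i, g.coeff i ∈ Set.range (MvPolynomial.aeval x : MvPolynomial (Fin ρ) k →ₐ[k] K).toRingHom := by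
    intro i
    have h := hA'B (hgcoef i)
    rw [hB, Algebra.adjoin_range_eq_range_aeval] at h
    obtain ⟨P, hP⟩ := h
    exact ⟨P, hP⟩
  obtain ⟨F, hFg, -, hFm⟩ :=
    lifts_and_degree_eq_and_monic ((lifts_iff_coeff_lifts g).mpr hgcoefB) hgmon
  have hF0 : F.eval₂ (MvPolynomial.aeval x).toRingHom η₁ = 0 := by
    rw [← eval_map, hFg, hgη]
  -- its reduction `F(0; T)` has the residue of `η₁` as a simple root
  have hcongrO : ∀ i, g.coeff i - algebraMap k K ((F.map MvPolynomial.constantCoeff).coeff i) ∈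
      {z | ∃ r : Fin ρ → K, (∀ i, r i ∈ O) ∧ z = ∑ i, r i * x i} := by
    intro i
    rw [← hFg, coeff_map, coeff_map, ← MvPolynomial.aeval_zero']
    have h := adHensel_aeval_sub_aeval_lo_mem_sp x lv 0 O hk hxO (F.coeff i)
    simp only [Nat.not_lt_zero, if_false] at h
    exact h
  have hfb1 : O.valuation (aeval η₁ (derivative (F.map MvPolynomial.constantCoeff))) = 1 :=
    valuation_eq_one_of_sub_lt O (valuation_lt_one_of_mem_sp O (fun _ h => h) hvx1
      (eval_sub_aeval_mem_sp hη₁O (coeff_derivative_sub_mem_sp hcongrO))) hgder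
      (valuation_aeval_le_one O hk hη₁O _)
  -- the adapted chart
  have hAVx : AdaptedValues (fun j => O.valuation (x j)) lv := by
    rw [hvxfun]
    exact hAV.1
  obtain ⟨R, hRO, hxR, hηR, hRT, hchart⟩ :=
    adHensel_assembly O hk x hx0 hvx1 hxi lv hAVx hη₁O F hF0 fun ℓ =>
      adHensel_level O hk x hx0 hvx1 hxi lv ℓ (adHensel_hi_small K O ρ x lv hvx1 hAVx.1 ℓ) hη₁O F
        hFm hF0 hfb1
  have hx'R : ∀ i, x' i ∈ R := fun i => by
    rw [hx'x i]
    exact prod_mem fun j _ => pow_mem (hxR j) _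
  refine ⟨ρ, R, hRO, x, hxR, lv, ?_, ?_, ?_, ?_⟩
  · -- `R ≤ M`
    intro z hz
    have hkM : Set.range (algebraMap k K) ⊆ M.toSubfield := by
      rintro _ ⟨c, rfl⟩
      exact M.algebraMap_mem c
    have hxM : ∀ j, x j ∈ M.toSubfield := fun j => prod_zpow_mem x' (fun i => (hx' i).2.2) (C j)
    exact hRT M.toSubfield hkM hxM hη₁M hz
  · -- `M ⊆ Frac R`
    refine hMcl.trans (Subfield.closure_le.mpr ?_)
    refine Set.union_subset (Set.union_subset ?_ ?_)
      (Set.singleton_subset_iff.mpr (Subfield.subset_closure hηR))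
    · rintro _ ⟨c, rfl⟩
      exact Subfield.subset_closure (R.algebraMap_mem c)
    · rintro _ ⟨i, rfl⟩
      exact Subfield.subset_closure (hx'R i)
  · -- flag-adapted
    refine (flagAdaptedChart_iff O R hRO x hxR lv).mpr ⟨hchart, ?_⟩
    rw [hvxfun]
    exact hAV.2
  · -- transcendence basis
    have hind : AlgebraicIndependent k x := by
      rw [algebraicIndependent_iff]
      intro P hP
      by_contra hP0
      obtain ⟨μ, -, hμ⟩ := adHensel_exists_dominant O hk x hx0 hxi P hP0
      rw [hP, map_zero] at hμ
      exact (Finset.prod_ne_zero_iff.mpr fun i _ =>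
        pow_ne_zero _ ((map_ne_zero O.valuation).mpr (hx0 i))) hμ.symm
    refine hind.isTranscendenceBasis_iff_isAlgebraic.mpr
      (IntermediateField.isAlgebraic_adjoin_iff_top.mp ⟨fun z => ?_⟩)
    have hle : Subfield.closure (((algebraMap k K).fieldRange : Set K) ∪ Set.range x') ≤
        (IntermediateField.adjoin k (Set.range x)).toSubfield := by
      rw [Subfield.closure_le]
      refine Set.union_subset ?_ ?_
      · rintro _ ⟨c, rfl⟩
        exact (IntermediateField.adjoin k (Set.range x)).algebraMap_mem c
      · rintro _ ⟨i, rfl⟩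
        exact IntermediateField.algebra_adjoin_le_adjoin _ _ (hx'B i)
    exact isAlgebraic_of_ringHom_comp_eq (Subfield.inclusion hle) (RingHom.ext fun _ => rfl) (hKalg z)

end Summit.ResolutionOfSingularities.ResolutionOfSingularities.Theorems.PfaffLine
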